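import Summits.ResolutionOfSingularities.ResolutionOfSingularities.Theorems.EquisingularLiftCampaignW45bBlowupChartPresentation
import HarnessLib

/-!
# [OURS · L1 W4.5(b)] L6 — Δ-MULT: the strict transform of an equimultiple hypersurface has multiplicity `≤ ν` at every rational point over the closed point

Crux chain w45b, working crux EL♮ = `Theses.EquisingularLift.EquisingularLiftNat` (stmt-ResolutionOfSingularities-20038), research
stub `stub_elnat_three`; helper L6 «Δ-MULT» of CRUX-PLAN v1.1 §3.4 (res-L1-w45b-plan-1): «in the situation of L1, at every point of
`V(y/e^ν)` over `𝔪` the order of `y/e^ν` is `≤ ν` [the `T′`-polynomial `Σ_b c′_{ν−b,b} T′^b` has roots of multiplicity `≤ ν`]» — the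
termination bookkeeping companion of AVOID-L1 (`…AvoidBadPoint.lean`, order `0` at the bad point) and L2 (`…UniqueBadPoint.lean`).
OURS; NOT a statement of any manuscript; AI-written, weaker than expert review. `--supports stmt-ResolutionOfSingularities-20038 --as helper`.

SETTING: `R` regular local, `e ∈ 𝔪 ∖ 𝔪²`, `w ∈ 𝔪²`, `w ∉ (e)`, `Z = V(e, w)`, `B = R[Z/e] = R[X]/(eX − w)` (p503573), `t = w/e`,
`y ∈ (e, w)^ν` with `y ∉ 𝔪^{ν+1}` (equimultiple), strict transform `b = y/e^ν`. The rational points of the `e`-chart over the closed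
point are the MAXIMAL ideals `𝔓_c = 𝔪B + (t − c)`, `c ∈ R`; for a maximal ideal the `𝔓_c`-adic order of `b` in `B_{𝔓_c}` is read on
ordinary powers (`𝔓_c^{(n)} = 𝔓_c^n`), so «`ord_{𝔓_c}(b) ≤ ν`» is the statement `b ∉ 𝔓_c^{ν+1}` proved here:

* `exists_ringHom_polynomial_residueField` — the REDUCTION map `ρ : B → k[X]`, `r ↦ r̄`, `t ↦ X` (`k = R/𝔪`; the relation
  `eX − w` dies since `e, w ∈ 𝔪`): the exceptional line of the chart is `Spec k[X]`;
* `exists_polynomial_aeval_eq_divPow` — `b = F(t)` for a polynomial `F ∈ R[X]` of degree `≤ ν` whose constant term `c₀` satisfies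
  `y = c₀ e^ν + w r`, `r ∈ (e, w)^{ν-1}` — hence is a UNIT when `y ∉ 𝔪^{ν+1}`;
* **`divPow_notMem_point_pow_succ`** (Δ-MULT) — `b ∉ 𝔓_c^{ν+1}` for every `c ∈ R`: `ρ(𝔓_c^{ν+1}) ⊆ ((X − c̄)^{ν+1})` while
  `ρ(b) = F̄ ≠ 0` has degree `≤ ν`. So a Δ/comb step never raises the multiplicity of the strict transform at the new points over the
  old singular point of the trace (at `c = 0` AVOID-L1 gives order `0`).

References: res-L1-w45b-plan-1 CRUX-PLAN v1.1 §3.4 L6 (OURS); J. Kollár, *Lectures on Resolution of Singularities* (2007), §3.9;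
V. Cossart, U. Jannsen, S. Saito (2020), §2 (Hilbert–Samuel under permissible blow-ups) — context only.
-/

noncomputable section

set_option linter.dupNamespace false -- mandated namespace `Summit.<Summit>.<Problem>` of this single-conjunct summit

open IsLocalRing IsLocalization Polynomial
open Literature.AlgebraicGeometry.Resolution

namespace Summit.ResolutionOfSingularities.ResolutionOfSingularities.Cruxes.EquisingularLiftNat.Sections

universe u

section Reduction

variable {R : Type u} [CommRing R] [IsLocalRing R] [IsDomain R] {a b : R}

/-- **The reduction map of the chart onto its exceptional line**: for a local domain `R`, `I = (a, b)` with `a, b ∈ 𝔪`, `a ≠ 0`,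
`a ∣ b x ⇒ a ∣ x`, there is a ring map `ρ : R[I/a] → k[X]` (`k = R/𝔪`) with `ρ(r) = r̄` and `ρ(b/a) = X` — the composite
`R[I/a] ≅ R[X]/(aX − b) → k[X]` (`aX − b ↦ āX − b̄ = 0`). [folklore] -/
theorem exists_ringHom_polynomial_residueField (I : Ideal R) (hI : I = Ideal.span {a, b}) (hb : b ∈ I)
    (ha : a ∈ maximalIdeal R) (hbm : b ∈ maximalIdeal R) (ha0 : a ≠ 0) (hab : ∀ x : R, a ∣ b * x → a ∣ x) :
    ∃ ρ : blowupAlgebra I a →+* (ResidueField R)[X],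
      ∀ p : R[X], ρ (Polynomial.aeval (blowupAlgebra.gen I a b hb) p) = p.map (residue R) := by
  have hsurj := aeval_gen_surjective_of_eq I hI hb
  have hker : RingHom.ker (Polynomial.aeval (R := R) (blowupAlgebra.gen I a b hb)).toRingHom ≤
      RingHom.ker (Polynomial.mapRingHom (residue R)) := by
    intro p hp
    have hp' : p ∈ RingHom.ker (Polynomial.aeval (R := R) (blowupAlgebra.gen I a b hb)) := hp
    rw [ker_aeval_gen_eq_span I hb ha0 hab, Ideal.mem_span_singleton] at hp'
    obtain ⟨g, rfl⟩ := hp'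
    rw [RingHom.mem_ker, Polynomial.coe_mapRingHom, Polynomial.map_mul, Polynomial.map_sub, Polynomial.map_mul,
      Polynomial.map_C, Polynomial.map_C, Polynomial.map_X, (residue_eq_zero_iff a).mpr ha,
      (residue_eq_zero_iff b).mpr hbm, map_zero, zero_mul, sub_zero, zero_mul]
  suffices H : ∀ f : R[X] →+* blowupAlgebra I a, Function.Surjective f →
      RingHom.ker f ≤ RingHom.ker (Polynomial.mapRingHom (residue R)) →
      ∃ ρ : blowupAlgebra I a →+* (ResidueField R)[X], ∀ p : R[X], ρ (f p) = p.map (residue R) from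
    H _ (fun z => hsurj z) hker
  intro f hf hk
  exact ⟨f.liftOfRightInverse (Function.surjInv hf) (Function.rightInverse_surjInv hf)
    ⟨Polynomial.mapRingHom (residue R), hk⟩, fun p => by
      rw [RingHom.liftOfRightInverse_comp_apply, Polynomial.coe_mapRingHom]⟩

end Reduction

section Multiplicity

variable {R : Type u} [CommRing R] {e w : R}

/-- **`y/e^ν` is a polynomial of degree `≤ ν` in `t = w/e`** whose constant term `c₀` satisfies `y = c₀ e^ν + w r`,
`r ∈ (e, w)^{ν-1}` (recursively from `(e,w)^ν = (e^ν) + w (e,w)^{ν-1}`: `y/e^ν = c₀ + t · (r/e^{ν-1})`). [folklore] -/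
theorem exists_polynomial_aeval_eq_divPow :
    ∀ (ν : ℕ) {y : R} (hy : y ∈ Ideal.span {e, w} ^ ν), ∃ (F : R[X]) (r : R),
      F.natDegree ≤ ν ∧ r ∈ Ideal.span {e, w} ^ (ν - 1) ∧ y = F.coeff 0 * e ^ ν + w * r ∧
        Polynomial.aeval (blowupAlgebra.gen (Ideal.span {e, w}) e w (mem_span_pair_right e w)) F =
          blowupAlgebra.divPow (Ideal.span {e, w}) e hy := by
  intro ν
  induction ν with
  | zero =>
    intro y hy
    refine ⟨C y, 0, by simp, Ideal.zero_mem _, by simp, ?_⟩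
    rw [Polynomial.aeval_C]
    exact Subtype.ext (by simp [Subalgebra.coe_algebraMap])
  | succ ν ih =>
    intro y hy
    obtain ⟨c, r, hr, hycr⟩ := exists_eq_mul_pow_add_mul_of_mem_span_pair_pow e w (ν + 1) hy
    rw [Nat.add_sub_cancel] at hr
    obtain ⟨F', r', hF', -, -, haev⟩ := ih hr
    refine ⟨C c + X * F', r, ?_, by rwa [Nat.add_sub_cancel], by
      rw [coeff_add, coeff_C_zero, coeff_X_mul_zero, add_zero]; exact hycr, ?_⟩
    · refine (natDegree_add_le _ _).trans (max_le (by simp) ?_)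
      exact natDegree_mul_le.trans (by have := natDegree_X_le (R := R); omega)
    · rw [map_add, map_mul, Polynomial.aeval_C, Polynomial.aeval_X, haev]
      apply Subtype.ext
      have hei : algebraMap R (Localization.Away e) e * Away.invSelf e = 1 := Away.mul_invSelf e
      have hpow : algebraMap R (Localization.Away e) e ^ (ν + 1) * Away.invSelf e ^ (ν + 1) = 1 := by
        rw [← mul_pow, hei, one_pow]
      simp only [blowupAlgebra.coe_divPow, Subalgebra.coe_add, Subalgebra.coe_mul, Subalgebra.coe_algebraMap,
        blowupAlgebra.coe_gen, hycr, map_add, map_mul, map_pow]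
      linear_combination (-(algebraMap R (Localization.Away e) c)) * hpow

variable [IsRegularLocalRing R]

/-- **The rational points `𝔓_c = 𝔪B + (w/e − c)` of the exceptional line are closed points**: `𝔓_c` is a maximal ideal of
`B = R[Z/e]` for every `c ∈ R` (`R` regular local, `e ∈ 𝔪 ∖ 𝔪²`, `w ∈ 𝔪² ∖ (e)`): it is proper because the reduction map
`ρ : B → k[X]` sends it into `(X − c̄)`, and modulo it every `p(t) ∈ B = R[t]` is the constant `p(c)`. (`c = 0`: `badPoint_isMaximal`.)
[folklore] -/
theorem point_isMaximal (he : e ∈ maximalIdeal R) (he₂ : e ∉ maximalIdeal R ^ 2) (hw : w ∈ maximalIdeal R ^ 2)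
    (hwe : w ∉ Ideal.span {e}) (c : R) :
    ((maximalIdeal R).map (algebraMap R (blowupAlgebra (Ideal.span {e, w}) e)) ⊔
      Ideal.span {blowupAlgebra.gen (Ideal.span {e, w}) e w (mem_span_pair_right e w) -
        algebraMap R (blowupAlgebra (Ideal.span {e, w}) e) c}).IsMaximal := by
  haveI := isDomain_of_isRegularLocalRing R
  have hprime : Prime e := IsRegularLocalRing.prime_of_not_mem_sq he he₂
  have hw₁ : w ∈ maximalIdeal R := Ideal.pow_le_self two_ne_zero hw
  have hab : ∀ x : R, e ∣ w * x → e ∣ x := fun x h =>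
    (hprime.dvd_or_dvd h).resolve_left fun h' => hwe (Ideal.mem_span_singleton.mpr h')
  obtain ⟨ρ, hρ⟩ := exists_ringHom_polynomial_residueField (Ideal.span {e, w}) rfl (mem_span_pair_right e w)
    he hw₁ hprime.ne_zero hab
  have hρC : ∀ s : R, ρ (algebraMap R (blowupAlgebra (Ideal.span {e, w}) e) s) = C (residue R s) := fun s => by
    rw [← Polynomial.aeval_C (blowupAlgebra.gen (Ideal.span {e, w}) e w (mem_span_pair_right e w)) s, hρ,
      Polynomial.map_C]
  have hρt : ρ (blowupAlgebra.gen (Ideal.span {e, w}) e w (mem_span_pair_right e w)) = X := by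
    rw [← Polynomial.aeval_X (R := R) (blowupAlgebra.gen (Ideal.span {e, w}) e w (mem_span_pair_right e w)), hρ,
      Polynomial.map_X]
  rw [Ideal.isMaximal_iff]
  constructor
  · -- proper: `ρ` maps it into `(X − c̄) ∌ 1`
    intro h1
    have h := Ideal.mem_map_of_mem ρ h1
    rw [Ideal.map_sup, Ideal.map_map, Ideal.map_span, Set.image_singleton, map_sub, hρt, hρC, map_one] at h
    have hle : (maximalIdeal R).map (ρ.comp (algebraMap R (blowupAlgebra (Ideal.span {e, w}) e))) ⊔
        Ideal.span {X - C (residue R c)} ≤ Ideal.span {X - C (residue R c)} := by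
      refine sup_le ?_ le_rfl
      rw [Ideal.map_le_iff_le_comap]
      intro m hm
      rw [Ideal.mem_comap, RingHom.comp_apply, hρC, (residue_eq_zero_iff m).mpr hm, map_zero]
      exact Ideal.zero_mem _
    have h1' := hle h
    rw [Ideal.mem_span_singleton] at h1'
    have hdeg := Polynomial.natDegree_le_of_dvd h1' one_ne_zero
    rw [natDegree_X_sub_C, natDegree_one] at hdeg
    exact Nat.not_succ_le_zero 0 hdeg
  · intro K z hJK hzJ hzK
    obtain ⟨p, rfl⟩ := aeval_gen_surjective e w z
    obtain ⟨g, hg⟩ := Polynomial.X_sub_C_dvd_sub_C_eval (p := p) (a := c)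
    have hdecomp : Polynomial.aeval (blowupAlgebra.gen (Ideal.span {e, w}) e w (mem_span_pair_right e w)) p =
        algebraMap R _ (p.eval c) +
          (blowupAlgebra.gen (Ideal.span {e, w}) e w (mem_span_pair_right e w) - algebraMap R _ c) *
            Polynomial.aeval (blowupAlgebra.gen (Ideal.span {e, w}) e w (mem_span_pair_right e w)) g := by
      have h := congrArg (Polynomial.aeval (blowupAlgebra.gen (Ideal.span {e, w}) e w (mem_span_pair_right e w))) hg
      rw [map_sub, Polynomial.aeval_C, map_mul, map_sub, Polynomial.aeval_X, Polynomial.aeval_C] at h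
      linear_combination h
    have htK : (blowupAlgebra.gen (Ideal.span {e, w}) e w (mem_span_pair_right e w) - algebraMap R _ c) *
        Polynomial.aeval (blowupAlgebra.gen (Ideal.span {e, w}) e w (mem_span_pair_right e w)) g ∈ K :=
      hJK (Ideal.mem_sup_right (Ideal.mul_mem_right _ _ (Ideal.mem_span_singleton_self _)))
    have hp0 : p.eval c ∉ maximalIdeal R := by
      intro h0
      apply hzJ
      rw [hdecomp]
      exact Ideal.add_mem _ (Ideal.mem_sup_left (Ideal.mem_map_of_mem _ h0))
        (Ideal.mem_sup_right (Ideal.mul_mem_right _ _ (Ideal.mem_span_singleton_self _)))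
    have hu : IsUnit (algebraMap R (blowupAlgebra (Ideal.span {e, w}) e) (p.eval c)) := by
      have : IsUnit (p.eval c) := by by_contra h; exact hp0 ((mem_maximalIdeal _).mpr h)
      exact this.map _
    have hcK : algebraMap R (blowupAlgebra (Ideal.span {e, w}) e) (p.eval c) ∈ K := by
      have h := K.sub_mem hzK htK
      rwa [hdecomp, add_sub_cancel_right] at h
    exact K.eq_top_iff_one.mp (K.eq_top_of_isUnit_mem hcK hu)

/-- **L6 — Δ-MULT: the multiplicity of the strict transform at the rational points over the closed point is at most `ν`.**
`R` regular local, `e ∈ 𝔪 ∖ 𝔪²`, `w ∈ 𝔪²`, `w ∉ (e)`, `y ∈ (e,w)^ν`, `y ∉ 𝔪^{ν+1}` (equimultiple along `Z = V(e,w)`). Then for every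
`c ∈ R` the strict transform `y/e^ν ∈ B = R[Z/e]` does NOT lie in the `(ν+1)`-st power of the maximal ideal `𝔓_c = 𝔪B + (w/e − c)`
(the rational point `t = c̄` of the exceptional line): reduce to the exceptional line `k[X]`, where `𝔓_c^{ν+1} ↦ ((X − c̄)^{ν+1})`
but `y/e^ν ↦ F̄ ≠ 0` of degree `≤ ν`. [folklore; CRUX-PLAN v1.1 §3.4 L6] -/
theorem divPow_notMem_point_pow_succ (he : e ∈ maximalIdeal R) (he₂ : e ∉ maximalIdeal R ^ 2)
    (hw : w ∈ maximalIdeal R ^ 2) (hwe : w ∉ Ideal.span {e}) {ν : ℕ} {y : R}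
    (hy : y ∈ Ideal.span {e, w} ^ ν) (hy' : y ∉ maximalIdeal R ^ (ν + 1)) (c : R) :
    blowupAlgebra.divPow (Ideal.span {e, w}) e hy ∉
      ((maximalIdeal R).map (algebraMap R (blowupAlgebra (Ideal.span {e, w}) e)) ⊔
        Ideal.span {blowupAlgebra.gen (Ideal.span {e, w}) e w (mem_span_pair_right e w) -
          algebraMap R (blowupAlgebra (Ideal.span {e, w}) e) c}) ^ (ν + 1) := by
  haveI := isDomain_of_isRegularLocalRing R
  set B := blowupAlgebra (Ideal.span {e, w}) e
  set t := blowupAlgebra.gen (Ideal.span {e, w}) e w (mem_span_pair_right e w)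
  have hprime : Prime e := IsRegularLocalRing.prime_of_not_mem_sq he he₂
  have hw₁ : w ∈ maximalIdeal R := Ideal.pow_le_self two_ne_zero hw
  have hab : ∀ x : R, e ∣ w * x → e ∣ x := fun x h =>
    (hprime.dvd_or_dvd h).resolve_left fun h' => hwe (Ideal.mem_span_singleton.mpr h')
  have hI : Ideal.span {e, w} ≤ maximalIdeal R := by
    rw [Ideal.span_le]
    rintro x (rfl | rfl)
    · exact he
    · exact hw₁
  -- `b = F(t)`, `deg F ≤ ν`, constant term a unit
  obtain ⟨F, r, hFdeg, hr, hycr, hFb⟩ := exists_polynomial_aeval_eq_divPow (e := e) (w := w) ν hy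
  have hc0 : F.coeff 0 ∉ maximalIdeal R := by
    intro h0
    apply hy'
    rw [hycr]
    refine Ideal.add_mem _ ?_ ?_
    · rw [pow_succ']
      exact Ideal.mul_mem_mul h0 (Ideal.pow_mem_pow he ν)
    · have h : w * r ∈ maximalIdeal R ^ (2 + (ν - 1)) := by
        rw [pow_add]; exact Ideal.mul_mem_mul hw (Ideal.pow_right_mono hI _ hr)
      exact Ideal.pow_le_pow_right (by omega) h
  -- the reduction map `ρ : B → k[X]`
  obtain ⟨ρ, hρ⟩ := exists_ringHom_polynomial_residueField (Ideal.span {e, w}) rfl (mem_span_pair_right e w)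
    he hw₁ hprime.ne_zero hab
  have hρC : ∀ s : R, ρ (algebraMap R B s) = C (residue R s) := fun s => by
    rw [← Polynomial.aeval_C t s, hρ, Polynomial.map_C]
  have hρt : ρ t = X := by rw [← Polynomial.aeval_X (R := R) t, hρ, Polynomial.map_X]
  -- `ρ(𝔓_c) ⊆ (X − c̄)`, hence `ρ(𝔓_c^{ν+1}) ⊆ ((X − c̄)^{ν+1})`
  have hρP : ((maximalIdeal R).map (algebraMap R B) ⊔ Ideal.span {t - algebraMap R B c}).map ρ ≤
      Ideal.span {X - C (residue R c)} := by
    rw [Ideal.map_sup, Ideal.map_map, Ideal.map_span, Set.image_singleton, map_sub, hρt, hρC]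
    refine sup_le ?_ le_rfl
    rw [Ideal.map_le_iff_le_comap]
    intro m hm
    rw [Ideal.mem_comap, RingHom.comp_apply, hρC, (residue_eq_zero_iff m).mpr hm, map_zero]
    exact Ideal.zero_mem _
  intro hb
  have hρb : ρ (blowupAlgebra.divPow (Ideal.span {e, w}) e hy) ∈ Ideal.span {(X - C (residue R c)) ^ (ν + 1)} := by
    rw [← Ideal.span_singleton_pow]
    have h := Ideal.mem_map_of_mem ρ hb
    rw [Ideal.map_pow] at h
    exact Ideal.pow_right_mono hρP _ h
  rw [← hFb, hρ, Ideal.mem_span_singleton] at hρb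
  -- degree count in `k[X]`
  have hF0 : F.map (residue R) ≠ 0 := by
    intro h
    have h0 := congrArg (fun q : (ResidueField R)[X] => q.coeff 0) h
    simp only [coeff_map, coeff_zero] at h0
    exact hc0 ((residue_eq_zero_iff _).mp h0)
  have h1 : ((X - C (residue R c)) ^ (ν + 1)).natDegree ≤ (F.map (residue R)).natDegree :=
    Polynomial.natDegree_le_of_dvd hρb hF0
  rw [(monic_X_sub_C _).natDegree_pow, natDegree_X_sub_C, mul_one] at h1
  have h2 : (F.map (residue R)).natDegree ≤ ν := natDegree_map_le.trans hFdeg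
  omega

/-- **L6, localised reading: `ord_{𝔓_c}(y/e^ν) ≤ ν`.** The image of `y/e^ν` in the local ring of the chart at the rational point
`𝔓_c = 𝔪B + (w/e − c)` (a maximal ideal) does not lie in the `(ν+1)`-st power of its maximal ideal. [folklore] -/
theorem algebraMap_divPow_notMem_maximalIdeal_pow_succ (he : e ∈ maximalIdeal R) (he₂ : e ∉ maximalIdeal R ^ 2)
    (hw : w ∈ maximalIdeal R ^ 2) (hwe : w ∉ Ideal.span {e}) {ν : ℕ} {y : R}
    (hy : y ∈ Ideal.span {e, w} ^ ν) (hy' : y ∉ maximalIdeal R ^ (ν + 1)) (c : R)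
    (𝔔 : Ideal (blowupAlgebra (Ideal.span {e, w}) e)) [𝔔.IsMaximal]
    (hm : (maximalIdeal R).map (algebraMap R (blowupAlgebra (Ideal.span {e, w}) e)) ≤ 𝔔)
    (ht : blowupAlgebra.gen (Ideal.span {e, w}) e w (mem_span_pair_right e w) -
      algebraMap R (blowupAlgebra (Ideal.span {e, w}) e) c ∈ 𝔔) :
    algebraMap (blowupAlgebra (Ideal.span {e, w}) e) (Localization.AtPrime 𝔔)
        (blowupAlgebra.divPow (Ideal.span {e, w}) e hy) ∉
      maximalIdeal (Localization.AtPrime 𝔔) ^ (ν + 1) := by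
  have hle : (maximalIdeal R).map (algebraMap R (blowupAlgebra (Ideal.span {e, w}) e)) ⊔
      Ideal.span {blowupAlgebra.gen (Ideal.span {e, w}) e w (mem_span_pair_right e w) -
        algebraMap R (blowupAlgebra (Ideal.span {e, w}) e) c} ≤ 𝔔 :=
    sup_le hm (by rw [Ideal.span_le, Set.singleton_subset_iff]; exact ht)
  intro h
  rw [← Localization.AtPrime.map_eq_maximalIdeal, ← Ideal.map_pow] at h
  -- `𝔔^{ν+1}` is `𝔔`-primary (𝔔 maximal), so its contraction from `B_𝔔` is itself
  have hrad : (𝔔 ^ (ν + 1)).radical = 𝔔 := by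
    rw [Ideal.radical_pow 𝔔 (Nat.succ_ne_zero ν)]; exact Ideal.IsPrime.radical inferInstance
  have hprim : (𝔔 ^ (ν + 1)).IsPrimary := Ideal.isPrimary_of_isMaximal_radical (by rw [hrad]; infer_instance)
  have hcomap : (Ideal.map (algebraMap (blowupAlgebra (Ideal.span {e, w}) e) (Localization.AtPrime 𝔔))
      (𝔔 ^ (ν + 1))).under (blowupAlgebra (Ideal.span {e, w}) e) = 𝔔 ^ (ν + 1) :=
    IsLocalization.under_map_of_isPrimary_disjoint 𝔔.primeCompl (Localization.AtPrime 𝔔) hprim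
      (Set.disjoint_left.mpr fun x hx hx' => hx (Ideal.pow_le_self (Nat.succ_ne_zero ν) hx'))
  have hb : blowupAlgebra.divPow (Ideal.span {e, w}) e hy ∈ 𝔔 ^ (ν + 1) := by
    rw [← hcomap, Ideal.under_def, Ideal.mem_comap]; exact h
  have heq := (point_isMaximal he he₂ hw hwe c).eq_of_le (Ideal.IsMaximal.ne_top inferInstance) hle
  rw [← heq] at hb
  exact divPow_notMem_point_pow_succ he he₂ hw hwe hy hy' c hb

end Multiplicity

end Summit.ResolutionOfSingularities.ResolutionOfSingularities.Cruxes.EquisingularLiftNat.Sections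

end
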